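import Summits.ResolutionOfSingularities.ResolutionOfSingularities.Theorems.FrobeniusLadderFInjectiveMacaulayficationNormBlockDuality
import Summits.ResolutionOfSingularities.ResolutionOfSingularities.Theorems.FrobeniusLadderFInjectiveMacaulayficationFrobeniusNormMinors
import Summits.ResolutionOfSingularities.ResolutionOfSingularities.Theorems.FrobeniusLadderFInjectiveMacaulayficationBlockDiagonalMinors
import Summits.ResolutionOfSingularities.ResolutionOfSingularities.Theorems.FrobeniusLadderFInjectiveMacaulayficationFrobeniusNormExtendScale
import HarnessLib

/-!
# LEMMA N♭ ASSEMBLED (modulo the K²-basis): `𝔮⁸` IS A FROBENIUS NORM IDEAL of every char-2 domain with `z² + x⁴z + (y³+u³+t³) = 0` carrying the monomial `2`-basis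
# (crux `FInjectiveMacaulayfication` stmt-ResolutionOfSingularities-15315, chain w45a, F-centre census Tier-2; res-L1-w45a-plan-1 R17.14 (3) / R18.1 (3);
# seat res-L1-w45a-lead-1 g8; scope `Cruxes/FInjectiveMacaulayfication/Lines/LEMMA-N-SCOPE.md`)

[OURS · L1 W4.5a] Support file (`--supports stmt-ResolutionOfSingularities-15315 --as helper`); replaces the role of NO printed item; NOT a statement of any
manuscript; def-free; AI-written (AI review is weaker than expert review).

THE ASSEMBLY of the Tier-2 target «`IsFrobeniusNormIdeal K 2 1 (𝔮⁸)`» from the landed pieces, GENERIC over a domain `R` with `2 = 0`, elements `x y u t z` with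
`z² + x⁴z + (y³+u³+t³) = 0`, `x ≠ 0`, `z ≠ 0`, and a fraction field `K` — taking as HYPOTHESES exactly what the K²-basis piece (B) (res-L1-w45a-stub-1 g10) supplies:
a `K²`-basis `β` of `K` indexed by `Fin 8 ⊕ Fin 8` (x-parity × the subsets `∅,y,u,t,yu,yt,ut,yut`) whose values are the 16 square-free monomials, and the
SQUARE-SPANNING property of the 32 generators `{m_ν, m_ν·z, x·m_ν, x·m_ν·z}` (`R = Σ_j R²·g_j`).

Chain (all by name): res-L1-w45a-stub-1's `FrobeniusNormMinors.frobeniusNorm_eq_span_det_of_rootRows` (norm module = span of the maximal minors of the explicit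
ROOT ROWS `G`; the 32 expansions `g_j = Σ_i (G j i)² β_i` are verified here: unit rows for `m_ν`, and `x⁻²·W′`-rows for `m_ν·z` through the identities
`Σ_μ (W′_{νμ})²·m_μ = m_ν·(z² + g) = x⁴z·m_ν`) → `BlockDiagonalMinors.span_maximalMinors_blockRows_eq_mul` (x-parity blocks: `I(G) = I(G₀)·I(G₀)`) →
`UnitRowMinors.span_maximalMinors_unitRowStack_eq` (`I([I ; X]) = Σ_k I_k(X)`) → res-L1-w45a-lead-1's `NormBlockDuality.span_minors_scaled_eq` (`= x⁻⁸·𝔮⁴·K`, pieces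
(J)(Q)(C)(D)) → squares: `[[F_*R]]_β = x⁻¹⁶·𝔮⁸·K` (`map_mulLeft_mul`, `IsLocalization.coeSubmodule_mul`) → `FrobeniusNormExtendScale.isFrobeniusNormIdeal_of_coeSubmodule_eq_map_mulLeft`
(`v = x¹⁶`). Result: ★ `isFrobeniusNormIdeal_pow_eight`. What remains for the UNCONDITIONAL `¬ LFBAdm 2 1 4`: (B) at `A₀ = k[x,y,u,t,z]/(f)`, `k` perfect (stub-1 g10),
then localisation to `𝒪_v` (`IsFrobeniusNormIdeal.map_of_isLocalization`), fraction-field transport (`FrobeniusNormTransport`), and res-L1-w45a-stub-2's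
`FCentreE1TierOneNormPow.not_lFBAdm_two_one_four_of_normPow` with `n = 8`, `c = 1`.
[folklore linear algebra over OURS computation; cite: Villamayoru2006, §2 p. 123 and Thm. 3.3/3.4 (norm of a module, F-blowup = its blow-up)]
-/

-- single-problem summit: the doubled namespace component is forced
set_option linter.dupNamespace false

noncomputable section

namespace Summit.ResolutionOfSingularities.ResolutionOfSingularities.Theorems.FInjectiveMacaulayfication.LemmaNAssembly

open Matrix Literature.AlgebraicGeometry.Resolution
open Summit.ResolutionOfSingularities.ResolutionOfSingularities.Theorems.FInjectiveMacaulayfication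

universe u

-- `R` and `K` in one universe: forced by `FrobeniusNormExtendScale` (`B K : Type u`)
variable {R : Type u} [CommRing R] {K : Type u} [Field K] [Algebra R K]

/-! ## §1 Two pieces of submodule algebra -/

/-- `v·I · w·J = (vw)·(I·J)` for `R`-submodules of an `R`-algebra `K`. [plumbing] -/
theorem map_mulLeft_mul (I J : Submodule R K) (v w : K) :
    I.map (LinearMap.mulLeft R v) * J.map (LinearMap.mulLeft R w) = (I * J).map (LinearMap.mulLeft R (v * w)) := by
  refine le_antisymm (Submodule.mul_le.mpr ?_) ?_
  · rintro _ ⟨a, ha, rfl⟩ _ ⟨b, hb, rfl⟩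
    refine Submodule.mem_map.mpr ⟨a * b, Submodule.mul_mem_mul ha hb, ?_⟩
    simp only [LinearMap.mulLeft_apply]; ring
  · refine Submodule.map_le_iff_le_comap.mpr (Submodule.mul_le.mpr ?_)
    intro a ha b hb
    refine Submodule.mem_comap.mpr ?_
    have : LinearMap.mulLeft R (v * w) (a * b) = (v * a) * (w * b) := by simp only [LinearMap.mulLeft_apply]; ring
    rw [this]
    exact Submodule.mul_mem_mul (Submodule.mem_map_of_mem ha) (Submodule.mem_map_of_mem hb)

/-- `(v⁻¹·N)` rescaled by `v` is `N`. [plumbing] -/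
theorem map_mulLeft_inv_mul_cancel (N : Submodule R K) {v : K} (hv : v ≠ 0) :
    (N.map (LinearMap.mulLeft R v⁻¹)).map (LinearMap.mulLeft R v) = N := by
  rw [← Submodule.map_comp, ← LinearMap.mulLeft_mul, mul_inv_cancel₀ hv, LinearMap.mulLeft_one, Submodule.map_id]

/-! ## §2 The root-row expansions: `Σ_μ (W′_{νμ})² · m_μ = m_ν · (z² + g)` -/

/-- The eight identities behind the root rows of `m_ν·√z`: with `m = (1, y, u, t, yu, yt, ut, yut)` and `W′` the one-block matrix,
`Σ_μ (W′_{νμ})²·m_μ = m_ν·(z² + (y³+u³+t³))` (pure ring identities). [by inspection] -/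
theorem sum_sq_entry_mul_mono (y u t z : R) (W : Matrix (Fin 8) (Fin 8) R)
    (hW : W = !![z, y, u, t, 0, 0, 0, 0;
      y ^ 2, z, 0, 0, u, t, 0, 0;
      u ^ 2, 0, z, 0, y, 0, t, 0;
      t ^ 2, 0, 0, z, 0, y, u, 0;
      0, u ^ 2, y ^ 2, 0, z, 0, 0, t;
      0, t ^ 2, 0, y ^ 2, 0, z, 0, u;
      0, 0, t ^ 2, u ^ 2, 0, 0, z, y;
      0, 0, 0, 0, t ^ 2, u ^ 2, y ^ 2, z]) (ν : Fin 8) :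
    ∑ μ : Fin 8, W ν μ ^ 2 * ![1, y, u, t, y * u, y * t, u * t, y * u * t] μ =
      ![1, y, u, t, y * u, y * t, u * t, y * u * t] ν * (z ^ 2 + (y ^ 3 + u ^ 3 + t ^ 3)) := by
  subst hW
  fin_cases ν <;> simp [Fin.sum_univ_eight] <;> ring

/-! ## §3 The assembly -/

set_option maxHeartbeats 1600000 in
-- thirty-two root-row expansions and four span identities in one proof
/-- ★ **LEMMA N♭, generic form**: let `R` be a domain with `2 = 0`, `x y u t z ∈ R` with `z² + x⁴z + (y³+u³+t³) = 0`, `x ≠ 0`, `z ≠ 0`, `K` a fraction field; suppose `K` has a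
`K²`-basis `β` indexed by `Fin 8 ⊕ Fin 8` with values `β (inl ν) = m_ν`, `β (inr ν) = x·m_ν` (`m = (1, y, u, t, yu, yt, ut, yut)`), and that every `w ∈ R` is
`Σ_j c_j²·g_j` over the 32 generators `g = (m_ν, m_ν z | x m_ν, x m_ν z)`. Then **`𝔮⁸ = (x², y, u, t, z)⁸` is a Frobenius norm ideal of `R` at level `e = 1`**
(indeed `[[F_*R]]_β = x⁻¹⁶·𝔮⁸·K`). [OURS · LEMMA N♭ modulo the K²-basis; cite: Villamayoru2006, §2 and 3.4] -/
theorem isFrobeniusNormIdeal_pow_eight [IsDomain R] [IsFractionRing R K] [ExpChar K 2]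
    (h2 : (2 : R) = 0) (x y u t z : R) (hf : z ^ 2 + x ^ 4 * z + (y ^ 3 + u ^ 3 + t ^ 3) = 0) (hx : x ≠ 0) (hz : z ≠ 0)
    (β : Module.Basis (Fin 8 ⊕ Fin 8) (iterateFrobeniusRange K 2 1) K)
    (hβ0 : ∀ ν : Fin 8, (β (Sum.inl ν) : K) = algebraMap R K (![1, y, u, t, y * u, y * t, u * t, y * u * t] ν))
    (hβ1 : ∀ ν : Fin 8, (β (Sum.inr ν) : K) = algebraMap R K (x * ![1, y, u, t, y * u, y * t, u * t, y * u * t] ν))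
    (hg : ∀ w : R, ∃ c : (Fin 8 ⊕ Fin 8) ⊕ (Fin 8 ⊕ Fin 8) → R, w = ∑ j, c j ^ 2 ^ 1 *
      Sum.elim (Sum.elim (fun ν => ![1, y, u, t, y * u, y * t, u * t, y * u * t] ν) (fun ν => ![1, y, u, t, y * u, y * t, u * t, y * u * t] ν * z))
        (Sum.elim (fun ν => x * ![1, y, u, t, y * u, y * t, u * t, y * u * t] ν) (fun ν => x * ![1, y, u, t, y * u, y * t, u * t, y * u * t] ν * z)) j) :
    IsFrobeniusNormIdeal K 2 1 (Ideal.span ({x ^ 2, y, u, t, z} : Set R) ^ 8) := by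
  classical
  -- names
  set m : Fin 8 → R := ![1, y, u, t, y * u, y * t, u * t, y * u * t] with hm
  set W : Matrix (Fin 8) (Fin 8) R := !![z, y, u, t, 0, 0, 0, 0;
      y ^ 2, z, 0, 0, u, t, 0, 0;
      u ^ 2, 0, z, 0, y, 0, t, 0;
      t ^ 2, 0, 0, z, 0, y, u, 0;
      0, u ^ 2, y ^ 2, 0, z, 0, 0, t;
      0, t ^ 2, 0, y ^ 2, 0, z, 0, u;
      0, 0, t ^ 2, u ^ 2, 0, 0, z, y;
      0, 0, 0, 0, t ^ 2, u ^ 2, y ^ 2, z] with hW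
  set xK : K := algebraMap R K x with hxK
  have hxK0 : xK ≠ 0 := by
    rw [hxK]; exact IsFractionRing.to_map_ne_zero_of_mem_nonZeroDivisors (mem_nonZeroDivisors_of_ne_zero hx)
  set X : Matrix (Fin 8) (Fin 8) K := (xK⁻¹ ^ 2) • W.map (algebraMap R K) with hX
  -- the block root-row family `G₀ = [I ; X]` and the block-diagonal family `G`
  set G₀ : Fin 8 ⊕ Fin 8 → Fin 8 → K := Sum.elim (fun i : Fin 8 => (Pi.single i 1 : Fin 8 → K)) (fun r j => X r j) with hG₀
  set G : (Fin 8 ⊕ Fin 8) ⊕ (Fin 8 ⊕ Fin 8) → Fin 8 ⊕ Fin 8 → K :=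
    fun j => Sum.elim (fun a => Sum.elim (G₀ a) (0 : Fin 8 → K)) (fun b => Sum.elim (0 : Fin 8 → K) (G₀ b)) j with hG
  -- `z² + g = x⁴ z`
  have h4 : x ^ 4 * z + x ^ 4 * z = 0 := by rw [← two_mul, h2, zero_mul]
  have hzg : z ^ 2 + (y ^ 3 + u ^ 3 + t ^ 3) = x ^ 4 * z := by linear_combination hf - h4
  -- the key `R`-identity behind the `X`-rows, pushed to `K`
  have hrow : ∀ ν : Fin 8, ∑ μ : Fin 8, X ν μ ^ 2 ^ 1 * algebraMap R K (m μ) = xK⁻¹ ^ 4 * algebraMap R K (x ^ 4 * z * m ν) := by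
    intro ν
    have hR := sum_sq_entry_mul_mono y u t z W hW ν
    rw [hzg] at hR
    have : ∑ μ : Fin 8, X ν μ ^ 2 ^ 1 * algebraMap R K (m μ) = xK⁻¹ ^ 4 * algebraMap R K (∑ μ : Fin 8, W ν μ ^ 2 * m μ) := by
      rw [map_sum, Finset.mul_sum]
      refine Finset.sum_congr rfl fun μ _ => ?_
      simp only [hX, Matrix.smul_apply, Matrix.map_apply, smul_eq_mul, map_mul, map_pow]
      ring
    rw [this, hR]
    simp only [map_mul, hm]
    ring
  -- the 32 expansions `g_j = Σ_i (G j i)² β_i`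
  have hGexp : ∀ j, algebraMap R K (Sum.elim (Sum.elim (fun ν => m ν) (fun ν => m ν * z)) (Sum.elim (fun ν => x * m ν) (fun ν => x * m ν * z)) j) =
      ∑ i, G j i ^ 2 ^ 1 * (β i : K) := by
    have hzero : ∀ f : Fin 8 → K, ∑ i : Fin 8, (0 : K) ^ 2 ^ 1 * f i = 0 := fun f => by simp
    have hunit : ∀ (ν : Fin 8) (f : Fin 8 → K), ∑ i : Fin 8, (Pi.single ν (1 : K) : Fin 8 → K) i ^ 2 ^ 1 * f i = f ν := fun ν f => by
      rw [Finset.sum_eq_single ν]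
      · simp
      · intro b _ hb; simp [hb]
      · intro h; exact absurd (Finset.mem_univ ν) h
    intro j
    rcases j with (ν | ν) | (ν | ν)
    · -- unit row, block 0
      simp only [Sum.elim_inl, Sum.elim_inr, hG, hG₀, Fintype.sum_sum_type, Pi.zero_apply]
      rw [hzero, hunit, add_zero, hβ0]
    · -- `X`-row, block 0
      simp only [Sum.elim_inl, Sum.elim_inr, hG, hG₀, Fintype.sum_sum_type, Pi.zero_apply]
      rw [hzero, add_zero]
      simp only [hβ0]
      rw [hrow ν, map_mul, map_mul, map_mul, map_pow, ← hxK]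
      field_simp
    · -- unit row, block 1
      simp only [Sum.elim_inl, Sum.elim_inr, hG, hG₀, Fintype.sum_sum_type, Pi.zero_apply]
      rw [hzero, hunit, zero_add, hβ1]
    · -- `X`-row, block 1
      simp only [Sum.elim_inl, Sum.elim_inr, hG, hG₀, Fintype.sum_sum_type, Pi.zero_apply]
      rw [hzero, zero_add]
      simp only [hβ1]
      have hrow' : ∑ μ : Fin 8, X ν μ ^ 2 ^ 1 * algebraMap R K (x * m μ) = xK * (xK⁻¹ ^ 4 * algebraMap R K (x ^ 4 * z * m ν)) := by
        rw [← hrow ν, Finset.mul_sum]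
        refine Finset.sum_congr rfl fun μ _ => ?_
        rw [map_mul, ← hxK]; ring
      rw [hrow', map_mul, map_mul, map_mul, map_mul, map_pow, ← hxK]
      field_simp
  -- STEP 1: the norm module is the span of the maximal minors of `G`
  have h1 := FrobeniusNormMinors.frobeniusNorm_eq_span_det_of_rootRows (K := K) (p := 2) (e := 1) (A := R) (β := β)
    (Sum.elim (Sum.elim (fun ν => m ν) (fun ν => m ν * z)) (Sum.elim (fun ν => x * m ν) (fun ν => x * m ν * z))) hg G hGexp
  -- STEP 2: block split `I(G) = I(G₀)·I(G₀)`
  have h2' : Submodule.span R (Set.range fun σ : Fin 8 ⊕ Fin 8 → (Fin 8 ⊕ Fin 8) ⊕ (Fin 8 ⊕ Fin 8) => (Matrix.of fun i => G (σ i)).det) =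
      Submodule.span R (Set.range fun σ₀ : Fin 8 → Fin 8 ⊕ Fin 8 => (Matrix.of fun i => G₀ (σ₀ i)).det) *
        Submodule.span R (Set.range fun σ₀ : Fin 8 → Fin 8 ⊕ Fin 8 => (Matrix.of fun i => G₀ (σ₀ i)).det) :=
    BlockDiagonalMinors.span_maximalMinors_blockRows_eq_mul (R := R) G₀ G₀
  -- STEP 3: unit rows: `I(G₀) = span of all minors of X`; STEP 4: piece (D)
  have h3 : Submodule.span R (Set.range fun σ₀ : Fin 8 → Fin 8 ⊕ Fin 8 => (Matrix.of fun i => G₀ (σ₀ i)).det) =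
      (IsLocalization.coeSubmodule K (Ideal.span ({x ^ 2, y, u, t, z} : Set R) ^ 4)).map (LinearMap.mulLeft R (xK⁻¹ ^ 8)) := by
    rw [hG₀, UnitRowMinors.span_maximalMinors_unitRowStack_eq (R := R) X, hX, hxK]
    exact NormBlockDuality.span_minors_scaled_eq h2 x y u t z hf hx hz W hW
  -- STEP 5: `[[F_*R]]_β = x⁻¹⁶·𝔮⁸·K`
  have h5 : frobeniusNorm β R = (IsLocalization.coeSubmodule K (Ideal.span ({x ^ 2, y, u, t, z} : Set R) ^ 8)).map
      (LinearMap.mulLeft R (xK ^ 16)⁻¹) := by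
    have e1 : xK⁻¹ ^ 8 * xK⁻¹ ^ 8 = (xK ^ 16)⁻¹ := by rw [← pow_add, inv_pow]
    have e2 : Ideal.span ({x ^ 2, y, u, t, z} : Set R) ^ 4 * Ideal.span ({x ^ 2, y, u, t, z} : Set R) ^ 4 =
        Ideal.span ({x ^ 2, y, u, t, z} : Set R) ^ 8 := by rw [← pow_add]
    rw [h1, h2', h3, map_mulLeft_mul, ← IsLocalization.coeSubmodule_mul, e1, e2]
  -- STEP 6: rescale by `v = x¹⁶`
  refine FrobeniusNormExtendScale.isFrobeniusNormIdeal_of_coeSubmodule_eq_map_mulLeft (B := R) β (v := xK ^ 16) (pow_ne_zero _ hxK0) ?_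
  rw [h5, map_mulLeft_inv_mul_cancel _ (pow_ne_zero _ hxK0)]

end Summit.ResolutionOfSingularities.ResolutionOfSingularities.Theorems.FInjectiveMacaulayfication.LemmaNAssembly

end
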